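import Summits.Ventures.HodgeRepro2.T5SU11ResolventTransformEdge
import Summits.Ventures.HodgeRepro2.T5SU11SphericalLpSharp

/-!
# The resolvent is symmetric on the exponentially decaying class: `⟨G^I_λ g, h⟩ = ⟨g, G^I_λ h⟩`

For `λ > 1` and two sources `g, h` of the exponentially decaying class at rates `ε_g, ε_h > 1`, Fubini on the
symmetric kernel `K_λ(t, s) = K_λ(s, t)` gives

**`∫_{(0,∞)} G^I_λ g · h sinh 2t dt = ∫_{(0,∞)} g · G^I_λ h sinh 2s ds`** (`inner_greenSolI_symm`)

— row 471's symmetry of the resolvent, now on the whole class. The integrability of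
`K_λ(t, s) g(s) h(t) sinh 2s sinh 2t` on `(0, ∞) × (0, ∞)` (`integrable_prod_kernel_of_dominated`) comes from the
domination `|h(t)| ≤ C_h φ_{λ′}(t)` by a spherical function with `1 < λ′ < λ`, `λ′ ≤ ε_h` (`φ_{λ′} ≥ e^{−λ′ t}`, row
422), against which the absolute inner integral is row 519's eigenfunction identity. Nothing is claimed about (N).

Blind lane: Mathlib + the HodgeRepro2 prefix only; no sorry; axioms ⊆ {propext, Classical.choice,
Quot.sound}.
-/

namespace Summit.Ventures.HodgeRepro2.T5SU11ResolventSymmetricClass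

open Filter Topology MeasureTheory
open Set (Ioi Ioc Icc)
open T5SU11Cartan T5SU11SphericalFunction T5SU11SphericalBounds T5SU11SphericalContinuous
  T5SU11SphericalSolutionSpaceAll T5SU11SphericalDecay T5SU11SphericalLpSharp T5SU11RadialGreenKernel
  T5SU11RadialGreenPositivity T5SU11RadialGreenImproper T5SU11RadialGreenImproperDecaySource
  T5SU11ResolventKernelComposition T5SU11ResolventEigenfunction T5SU11ResolventTransformClass
  T5SU11ResolventTransformEdge

section measure

variable [MeasurableSpace Circle] [BorelSpace Circle]

/-- A source of the class at a rate `ε > 1` is dominated by a spherical function: for every `1 < λ′ ≤ ε`,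
`|h(t)| ≤ C′ φ_{λ′}(t)` on `(0, ∞)`. -/
theorem exists_abs_le_mul_sph {h : ℝ → ℝ} (hh : ContinuousOn h (Ioi 0))
    {M : ℝ} (hM : ∀ s ∈ Ioc (0 : ℝ) 1, |h s| ≤ M) {ε C s₀ : ℝ} (hC : ∀ s, s₀ ≤ s → |h s| ≤ C * Real.exp (-ε * s))
    {lam' : ℝ} (h1 : 1 < lam') (hle : lam' ≤ ε) :
    ∃ C' : ℝ, 0 ≤ C' ∧ ∀ t, 0 < t → |h t| ≤ C' * sph lam' (hyp t) := by
  have hC0 : 0 ≤ C := by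
    have hb0 := hC (max s₀ 0) (le_max_left _ _)
    have := abs_nonneg (h (max s₀ 0))
    have := Real.exp_pos (-ε * max s₀ 0)
    nlinarith
  -- `|h| ≤ M₁` on `[1, T]`, `T = max s₀ 1`, by continuity; `|h| ≤ C e^{−λ′ t}` beyond `T`
  set T := max s₀ 1 with hT
  have hT1 : 1 ≤ T := le_max_right _ _
  obtain ⟨t₁, _, hmax⟩ := isCompact_Icc.exists_isMaxOn (Set.nonempty_Icc.mpr hT1)
    ((hh.mono (fun t ht => lt_of_lt_of_le one_pos ht.1)).abs : ContinuousOn (fun t => |h t|) (Icc 1 T))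
  set M₁ := |h t₁| with hM₁
  have hM₁0 : 0 ≤ M₁ := abs_nonneg _
  -- on `(0, T]`: `|h| ≤ max M M₁ ≤ max M M₁ · e^{λ′ T} · e^{−λ′ t} ≤ max M M₁ e^{λ′ T} φ_{λ′}(t)`
  refine ⟨max M M₁ * Real.exp (lam' * T) + C, by positivity, fun t ht => ?_⟩
  have hφ : Real.exp (-(lam' * t)) ≤ sph lam' (hyp t) := exp_neg_mul_le_sph_hyp (by linarith) ht.le
  have hφ0 : 0 < sph lam' (hyp t) := sph_hyp_pos lam' t
  rcases le_or_gt t T with htT | htT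
  · have hb : |h t| ≤ max M M₁ := by
      rcases le_or_gt t 1 with ht1 | ht1
      · exact le_trans (hM t ⟨ht, ht1⟩) (le_max_left _ _)
      · exact le_trans ((isMaxOn_iff.mp hmax) t ⟨ht1.le, htT⟩) (le_max_right _ _)
    have h2 : 1 ≤ Real.exp (lam' * T) * Real.exp (-(lam' * t)) := by
      rw [← Real.exp_add]
      apply Real.one_le_exp
      nlinarith
    calc |h t| ≤ max M M₁ := hb
      _ = max M M₁ * 1 := (mul_one _).symm
      _ ≤ max M M₁ * (Real.exp (lam' * T) * Real.exp (-(lam' * t))) :=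
          mul_le_mul_of_nonneg_left h2 (le_max_of_le_right hM₁0)
      _ ≤ max M M₁ * (Real.exp (lam' * T) * sph lam' (hyp t)) :=
          mul_le_mul_of_nonneg_left (mul_le_mul_of_nonneg_left hφ (Real.exp_pos _).le) (le_max_of_le_right hM₁0)
      _ ≤ (max M M₁ * Real.exp (lam' * T) + C) * sph lam' (hyp t) := by nlinarith
  · have hb : |h t| ≤ C * Real.exp (-ε * t) := hC t (le_trans (le_max_left _ _) htT.le)
    have h2 : Real.exp (-ε * t) ≤ Real.exp (-(lam' * t)) := by
      apply Real.exp_le_exp.mpr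
      nlinarith
    calc |h t| ≤ C * Real.exp (-ε * t) := hb
      _ ≤ C * Real.exp (-(lam' * t)) := mul_le_mul_of_nonneg_left h2 hC0
      _ ≤ C * sph lam' (hyp t) := mul_le_mul_of_nonneg_left hφ hC0
      _ ≤ (max M M₁ * Real.exp (lam' * T) + C) * sph lam' (hyp t) := by
          have : 0 ≤ max M M₁ * Real.exp (lam' * T) := by positivity
          nlinarith

variable {lam : ℝ} (hlam : 1 < lam)
  {g : ℝ → ℝ} (hg : ContinuousOn g (Ioi 0))
  {M : ℝ} (hM : ∀ s ∈ Ioc (0 : ℝ) 1, |g s| ≤ M) (hM0 : 0 ≤ M)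
  {ε C s₀ : ℝ} (hC : ∀ s, s₀ ≤ s → |g s| ≤ C * Real.exp (-ε * s))
  {h : ℝ → ℝ} (hh : ContinuousOn h (Ioi 0))
  {M' : ℝ} (hM' : ∀ s ∈ Ioc (0 : ℝ) 1, |h s| ≤ M') (hM'0 : 0 ≤ M')
  {ε' C' s₀' : ℝ} (hC' : ∀ s, s₀' ≤ s → |h s| ≤ C' * Real.exp (-ε' * s))

include hlam hg hM hM0 hC hh hM' hC' in
/-- **The product integrand `K_λ(t, s) g(s) sinh 2s · h(t) sinh 2t` is integrable on `(0, ∞) × (0, ∞)`** for two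
sources of the class at rates `ε, ε′ > 1`. -/
theorem integrable_prod_kernel_of_dominated (hε1 : 1 < ε) (hε'1 : 1 < ε') :
    Integrable (Function.uncurry fun t s => sphGreenKernel lam t s * g s * Real.sinh (2 * s)
        * (h t * Real.sinh (2 * t)))
      ((volume.restrict (Ioi 0)).prod (volume.restrict (Ioi 0))) := by
  -- a spherical function dominating `h`: `1 < λ′ < λ`, `λ′ ≤ ε′`, `λ′ < ε`
  set lam' := (1 + min (min ε ε') lam) / 2 with hlam'
  have hmin : 1 < min (min ε ε') lam := lt_min (lt_min hε1 hε'1) hlam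
  have h1 : 1 < lam' := by rw [hlam']; linarith
  have hlam'lt : lam' < min (min ε ε') lam := by rw [hlam']; linarith
  have h2 : lam' < lam := lt_of_lt_of_le hlam'lt (min_le_right _ _)
  have hle' : lam' ≤ ε' := le_of_lt (lt_of_lt_of_le hlam'lt (le_trans (min_le_left _ _) (min_le_right _ _)))
  have hlt : lam' < ε := lt_of_lt_of_le hlam'lt (le_trans (min_le_left _ _) (min_le_left _ _))
  obtain ⟨Cw, hCw0, hCw⟩ := exists_abs_le_mul_sph hh hM' hC' h1 hle'
  have hχ : ContinuousOn (sphDecay lam) (Ioi 0) :=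
    fun _ hr => (hasDerivAt_sphDecay hlam hr).continuousAt.continuousWithinAt
  -- measurability
  have hmeas : AEStronglyMeasurable (Function.uncurry fun t s => sphGreenKernel lam t s * g s * Real.sinh (2 * s)
      * (h t * Real.sinh (2 * t))) ((volume.restrict (Ioi 0)).prod (volume.restrict (Ioi 0))) := by
    rw [Measure.prod_restrict]
    refine ContinuousOn.aestronglyMeasurable ?_ (measurableSet_Ioi.prod measurableSet_Ioi)
    have hK : ContinuousOn (fun p : ℝ × ℝ => sphGreenKernel lam p.1 p.2) (Ioi 0 ×ˢ Ioi 0) := by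
      simp only [sphGreenKernel, greenKernel]
      apply ContinuousOn.neg
      apply ContinuousOn.mul
      · exact ((continuous_sph_hyp lam).comp (continuous_fst.min continuous_snd)).continuousOn
      · exact hχ.comp (continuous_fst.max continuous_snd).continuousOn
          (fun p hp => Set.mem_Ioi.mpr (lt_of_lt_of_le (Set.mem_Ioi.mp hp.1) (le_max_left _ _)))
    have hg' : ContinuousOn (fun p : ℝ × ℝ => g p.2) (Ioi 0 ×ˢ Ioi 0) :=
      hg.comp continuous_snd.continuousOn (fun p hp => hp.2)
    have hh' : ContinuousOn (fun p : ℝ × ℝ => h p.1) (Ioi 0 ×ˢ Ioi 0) :=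
      hh.comp continuous_fst.continuousOn (fun p hp => hp.1)
    exact ((hK.mul hg').mul
      (Real.continuous_sinh.comp (continuous_const.mul continuous_snd)).continuousOn).mul
      (hh'.mul (Real.continuous_sinh.comp (continuous_const.mul continuous_fst)).continuousOn)
  -- domination by `Cw` times row 520's integrand with the spherical function `φ_{λ′}`
  have hdom := (integrable_prod_kernel hlam h1 h2 hg hM hM0 hlt hC).norm.const_mul Cw
  refine Integrable.mono' hdom hmeas ?_
  rw [Measure.prod_restrict]
  refine (ae_restrict_iff' (measurableSet_Ioi.prod measurableSet_Ioi)).mpr (Eventually.of_forall fun p hp => ?_)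
  obtain ⟨t, s⟩ := p
  have ht0 : 0 < t := hp.1
  have hs0 : 0 < s := hp.2
  have hsinh : 0 ≤ Real.sinh (2 * t) := Real.sinh_nonneg_iff.mpr (by linarith)
  have hsinh' : 0 ≤ Real.sinh (2 * s) := Real.sinh_nonneg_iff.mpr (by linarith)
  simp only [Function.uncurry_apply_pair, Real.norm_eq_abs]
  rw [abs_mul, abs_mul, abs_mul, abs_mul, abs_of_nonneg hsinh, abs_of_nonneg hsinh',
    abs_mul, abs_mul, abs_mul, abs_mul, abs_of_nonneg hsinh, abs_of_nonneg hsinh',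
    abs_of_pos (sph_hyp_pos lam' t)]
  have := hCw t ht0
  have hK0 := abs_nonneg (sphGreenKernel lam t s)
  have hg0 := abs_nonneg (g s)
  calc |sphGreenKernel lam t s| * |g s| * Real.sinh (2 * s) * (|h t| * Real.sinh (2 * t))
      ≤ |sphGreenKernel lam t s| * |g s| * Real.sinh (2 * s) * (Cw * sph lam' (hyp t) * Real.sinh (2 * t)) := by
        gcongr
    _ = Cw * (|sphGreenKernel lam t s| * |g s| * Real.sinh (2 * s) * (sph lam' (hyp t) * Real.sinh (2 * t))) := by
        ring

include hlam hg hM hM0 hC hh hM' hM'0 hC' in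
/-- **THE RESOLVENT IS SYMMETRIC ON THE EXPONENTIALLY DECAYING CLASS**: for two sources at rates `ε, ε′ > 1`,
`∫_{(0,∞)} G^I_λ g · h sinh 2t dt = ∫_{(0,∞)} g · G^I_λ h sinh 2s ds`. -/
theorem inner_greenSolI_symm (hε1 : 1 < ε) (hε'1 : 1 < ε') :
    ∫ t in Ioi 0, greenSolI (fun t => sph lam (hyp t)) (sphDecay lam) g t * h t * Real.sinh (2 * t)
      = ∫ s in Ioi 0, g s * greenSolI (fun t => sph lam (hyp t)) (sphDecay lam) h s * Real.sinh (2 * s) := by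
  have hF := integrable_prod_kernel_of_dominated hlam hg hM hM0 hC hh hM' hC' hε1 hε'1
  have hswap := integral_integral_swap hF
  have hε : 2 - lam < ε := by linarith
  have hε' : 2 - lam < ε' := by linarith
  have hB := integrableOn_sph_mul_mul_sinh_Ioc hg hM hM0 lam
  have hA := integrableOn_sphDecay_mul_mul_sinh hlam hg hM hM0 hε hC
  have hB' := integrableOn_sph_mul_mul_sinh_Ioc hh hM' hM'0 lam
  have hA' := integrableOn_sphDecay_mul_mul_sinh hlam hh hM' hM'0 hε' hC'
  have hL : ∫ t in Ioi 0, ∫ s in Ioi 0, sphGreenKernel lam t s * g s * Real.sinh (2 * s) * (h t * Real.sinh (2 * t))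
      = ∫ t in Ioi 0, greenSolI (fun t => sph lam (hyp t)) (sphDecay lam) g t * h t * Real.sinh (2 * t) := by
    apply setIntegral_congr_fun measurableSet_Ioi
    intro t ht
    have ht0 : 0 < t := ht
    simp only
    rw [MeasureTheory.integral_mul_const, greenSolI_eq_integral_kernel hB hA ht0]
    simp only [sphGreenKernel]
    ring
  have hR : ∫ s in Ioi 0, ∫ t in Ioi 0, sphGreenKernel lam t s * g s * Real.sinh (2 * s) * (h t * Real.sinh (2 * t))
      = ∫ s in Ioi 0, g s * greenSolI (fun t => sph lam (hyp t)) (sphDecay lam) h s * Real.sinh (2 * s) := by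
    apply setIntegral_congr_fun measurableSet_Ioi
    intro s hs
    have hs0 : 0 < s := hs
    simp only
    have e : ∀ t, sphGreenKernel lam t s * g s * Real.sinh (2 * s) * (h t * Real.sinh (2 * t))
        = sphGreenKernel lam s t * h t * Real.sinh (2 * t) * (g s * Real.sinh (2 * s)) := by
      intro t
      rw [sphGreenKernel_symm lam t s]
      ring
    simp only [e]
    rw [MeasureTheory.integral_mul_const]
    simp only [sphGreenKernel]
    rw [← greenSolI_eq_integral_kernel hB' hA' hs0]
    ring
  rw [← hL, hswap, hR]

end measure

end Summit.Ventures.HodgeRepro2.T5SU11ResolventSymmetricClass
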